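import Summits.BirchSwinnertonDyer.Rank1Residual.X11b.CastellaErratumHeegner
import Summits.BirchSwinnertonDyer.Rank1Residual.X11b.TwistTransportUnit
import Mathlib.RingTheory.Polynomial.Cyclotomic.Roots
import HarnessLib

/-!
# X11b, route R1 — two unit lemmas for the Gross–Zagier bookkeeping: `p ∤ w_K` and `ord_p u(Cd) = 0`

HONEST FRAMING (cell `b2b-bsdres`, verbatim): the goal of the cell is to DELETE the
COMBINATION-SHAPED residual classes for ALL analytic-rank `≤ 1` curves over `ℚ` — "full BSD
formula for every rank `≤ 1` curve in class C" assembled STRICTLY from published theorems — so that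
the rank-`≤ 1` remainder becomes exactly the CONSTRUCTION-SHAPED classes, which are TYPED
(missing-input `Prop`s), NOT attempted. This is not "finishing BSD". Sub-cell `b2b-bsdres-multr1-p1`,
research route R1 for X11b (Castella 2018 Thm. A re-proved along the author's erratum). THEOREMS
ONLY (tree plumbing for `CastellaErratumGrossZagier.lean`); nothing asserted.

* `not_dvd_torsionOrder_of_finrank_le_two` — for a number field of degree `≤ 2` and a prime
  `p ≥ 5`, `p ∤ w_K = #(𝓞_K^×)_tors`: a generator of the cyclic torsion is a primitive `w_K`-th root
  of unity whose minimal polynomial over `ℚ` is the cyclotomic polynomial, of degree `φ(w_K) ≤ 2`,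
  while `p ∣ w_K` forces `φ(w_K) ≥ p − 1 ≥ 4` (`Nat.totient_super_multiplicative`). (So
  `w_K ∈ {2,4,6}`: the `u_K²` of the Gross–Zagier constant is a `p`-unit.)
* `padicValRat_u_eq_zero_of_twist_minimal_of_splitsIn` — for `W/ℚ` globally minimal, `K`
  quadratic with `p` SPLIT in `K`, and `Wd = Cd • W^{(d_K)}` globally minimal: `ord_p u(Cd) = 0`
  (the erratum-field form of `multr1-p2`'s `padicValRat_u_eq_zero_of_twist_minimal`, same proof:
  `d_K ∈ (ℚ_p^×)²` by `isSquare_padic_discr_of_splitsIn`, `p ∤ d_K` by `not_dvd_discr_of_splitsIn`,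
  both models `ℤ_p`-minimal, Silverman *AEC* VII.1.3(b)).
-/

noncomputable section

open scoped Classical

open WeierstrassCurve NumberField Literature.NumberTheory.EllipticCurves
  Literature.NumberTheory.EllipticCurves.Rank1Residual

namespace Summit.BirchSwinnertonDyer.Rank1Residual.X11b

section Units

/-- **`p ∤ #𝓞_K^×` for a field of degree `≤ 2` and a prime `p ≥ 5`**: a generator `ζ` of the
(cyclic) torsion of `𝓞_K^×` is a primitive `w_K`-th root of unity, its minimal polynomial is the
cyclotomic polynomial of degree `φ(w_K) ≤ [K:ℚ] ≤ 2`, while `p ∣ w_K` would force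
`φ(w_K) ≥ p − 1 ≥ 4`. (So `w_K ∈ {2, 4, 6}`.) [folklore] -/
theorem not_dvd_torsionOrder_of_finrank_le_two (K : Type*) [Field K] [NumberField K]
    (h2 : Module.finrank ℚ K ≤ 2) {p : ℕ} (hp : p.Prime) (hp5 : 5 ≤ p) :
    ¬ p ∣ (Units.torsionOrder K : ℕ) := by
  intro hdvd
  set w : ℕ := (Units.torsionOrder K : ℕ) with hw
  have hw0 : 0 < w := Units.torsionOrder_pos K
  -- a generator of the cyclic torsion group
  obtain ⟨g, hg⟩ := IsCyclic.exists_ofOrder_eq_natCard (α := Units.torsion K)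
  have hcard : Nat.card (Units.torsion K) = w := by rw [hw, Units.torsionOrder]
  rw [hcard] at hg
  have hprim : IsPrimitiveRoot g w := by rw [← hg]; exact IsPrimitiveRoot.orderOf g
  -- as an element of `K`
  set ζ : K := (((g : (𝓞 K)ˣ) : 𝓞 K) : K) with hζ
  have hprimK : IsPrimitiveRoot ζ w := by
    have h1 : IsPrimitiveRoot (g : (𝓞 K)ˣ) w := IsPrimitiveRoot.coe_submonoidClass_iff.mpr hprim
    have h2' : IsPrimitiveRoot ((g : (𝓞 K)ˣ) : 𝓞 K) w := IsPrimitiveRoot.coe_units_iff.mpr h1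
    exact h2'.map_of_injective RingOfIntegers.coe_injective
  -- the minimal polynomial of `ζ` is the cyclotomic polynomial, of degree `φ(w) ≤ 2`
  have hmin := Polynomial.cyclotomic_eq_minpoly_rat hprimK hw0
  have hdeg : w.totient ≤ 2 := by
    have h := minpoly.natDegree_le (A := ℚ) ζ
    rw [← hmin, Polynomial.natDegree_cyclotomic] at h
    exact h.trans h2
  -- but `p ∣ w` forces `φ(w) ≥ p − 1 ≥ 4`
  obtain ⟨k, hk⟩ := hdvd
  have hk0 : 0 < k := Nat.pos_of_ne_zero (by rintro rfl; simp [hk] at hw0)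
  have htot : p.totient * k.totient ≤ w.totient := by
    rw [hk]; exact Nat.totient_super_multiplicative p k
  have hpt : p.totient = p - 1 := Nat.totient_prime hp
  have hkt : 0 < k.totient := Nat.totient_pos.mpr hk0
  have : p - 1 ≤ w.totient := by
    calc p - 1 = p.totient * 1 := by rw [hpt, mul_one]
      _ ≤ p.totient * k.totient := Nat.mul_le_mul_left _ hkt
      _ ≤ w.totient := htot
  omega

end Units

section TwistUnit

/-- **`ord_p u(Cd) = 0` for the minimal model of the twist at a prime `p` split in `K`** (the
erratum-field analogue of `multr1-p2`'s `padicValRat_u_eq_zero_of_twist_minimal`, same proof):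
`W ⊗ ℚ_p` and `Wd ⊗ ℚ_p` are `ℚ_p`-isomorphic (`d_K ∈ (ℚ_p^×)²`, `isSquare_padic_discr_of_splitsIn`)
`ℤ_p`-minimal equations (`isMinimal_map_padic_of_isGloballyMinimal`), so `v_p(Δ(Wd)) = v_p(Δ(W))`
(Silverman *AEC* VII.1.3(b)), while `Δ(Wd) = u⁻¹² d_K⁶ Δ(W)` with `p ∤ d_K`
(`not_dvd_discr_of_splitsIn`). [cite: SilvermanAEC2009, VII.1 Prop. 1.3(b) and X.5 Cor. 5.4] -/
theorem padicValRat_u_eq_zero_of_twist_minimal_of_splitsIn (W : WeierstrassCurve ℚ) [W.IsElliptic]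
    [W.IsGloballyMinimal] (p : ℕ) [Fact p.Prime] (K : Type) [Field K] [NumberField K]
    (h2 : Module.finrank ℚ K = 2) (hs : SplitsIn K p) {Wd : WeierstrassCurve ℚ} [Wd.IsElliptic]
    [Wd.IsGloballyMinimal] (Cd : VariableChange ℚ)
    (hWd : Cd • W.quadraticTwist (NumberField.discr K : ℚ) = Wd) :
    padicValRat p (Cd.u : ℚ) = 0 := by
  have hp : p.Prime := Fact.out
  set d : ℚ := (NumberField.discr K : ℚ) with hd_def
  have hD0 : d ≠ 0 := by rw [hd_def]; exact_mod_cast NumberField.discr_ne_zero K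
  haveI : (W.baseChange ℚ_[p]).IsElliptic :=
    inferInstanceAs (W.map (algebraMap ℚ ℚ_[p])).IsElliptic
  haveI : (W.quadraticTwist d).IsElliptic := W.isElliptic_quadraticTwist hD0
  have hsq : IsSquare (algebraMap ℚ ℚ_[p] d) := by
    have h := isSquare_padic_discr_of_splitsIn h2 hs
    rwa [hd_def]
  have hpd : ¬ (p : ℤ) ∣ NumberField.discr K := not_dvd_discr_of_splitsIn h2 hp hs
  obtain ⟨θ, hθ⟩ := hsq
  have hθ0 : θ ≠ 0 := by
    rintro rfl
    exact (map_ne_zero (algebraMap ℚ ℚ_[p])).mpr hD0 (hθ.trans (mul_zero 0))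
  set X : WeierstrassCurve ℚ_[p] := W.baseChange ℚ_[p] with hX
  set Y : WeierstrassCurve ℚ_[p] := Wd.baseChange ℚ_[p] with hY
  haveI hXmin : X.IsMinimal ℤ_[p] := isMinimal_map_padic_of_isGloballyMinimal W p
  haveI hYmin : Y.IsMinimal ℤ_[p] := isMinimal_map_padic_of_isGloballyMinimal Wd p
  obtain ⟨C, hC⟩ := (W.baseChange ℚ_[p]).exists_variableChange_smul_eq_quadraticTwist_sq hθ0
  have h1 : (W.quadraticTwist d).baseChange ℚ_[p] = C • X := by
    rw [hC, baseChange, baseChange, map_quadraticTwist, hθ, sq]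
  have hYX : Y = (Cd.map (algebraMap ℚ ℚ_[p]) * C) • X := by
    rw [hY, ← hWd, WeierstrassCurve.VariableChange.baseChange_smul_eq (W.quadraticTwist d) Cd ℚ_[p],
      h1, mul_smul]
  set V := (IsDiscreteValuationRing.maximalIdeal ℤ_[p]).valuation ℚ_[p] with hV
  have hval : V Y.Δ = V X.Δ := valuation_Δ_eq_of_isMinimal_of_eq_smul ℤ_[p] hYX
  have hΔd : Wd.Δ = (↑Cd.u⁻¹ : ℚ) ^ 12 * (d ^ 6 * W.Δ) := by
    rw [← hWd, variableChange_Δ, quadraticTwist_Δ]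
  have hYΔ : Y.Δ = algebraMap ℚ ℚ_[p] Wd.Δ := by rw [hY, baseChange, map_Δ]
  have hXΔ : X.Δ = algebraMap ℚ ℚ_[p] W.Δ := by rw [hX, baseChange, map_Δ]
  rw [hYΔ, hXΔ, hΔd] at hval
  simp only [map_mul, map_pow] at hval
  have hΔ0 : V (algebraMap ℚ ℚ_[p] W.Δ) ≠ 0 :=
    (Valuation.ne_zero_iff V).mpr ((map_ne_zero _).mpr W.isUnit_Δ.ne_zero)
  have hvd : V (algebraMap ℚ ℚ_[p] d) = 1 := by
    have : algebraMap ℚ ℚ_[p] d = ((NumberField.discr K : ℤ) : ℚ_[p]) := by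
      rw [hd_def, map_intCast]
    rw [this]
    exact valuation_maximalIdeal_intCast_eq_one p hpd
  rw [hvd, one_pow, one_mul, mul_left_eq_self₀] at hval
  have hu12 : V (algebraMap ℚ ℚ_[p] (↑Cd.u⁻¹ : ℚ)) ^ 12 = 1 := hval.resolve_right hΔ0
  have hu1 : V (algebraMap ℚ ℚ_[p] (↑Cd.u⁻¹ : ℚ)) = 1 :=
    (pow_eq_one_iff_left (by norm_num)).mp hu12
  have hu : V ((Cd.u : ℚ) : ℚ_[p]) = 1 := by
    rw [Units.val_inv_eq_inv_val, map_inv₀, map_inv₀, inv_eq_one] at hu1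
    rw [← hu1, eq_ratCast]
  exact padicValRat_eq_zero_of_valuation_eq_one p (Cd.u.ne_zero) hu

end TwistUnit

end Summit.BirchSwinnertonDyer.Rank1Residual.X11b

end
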